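import Summits.ValiantsHypothesis.ValiantsHypothesis.Theorems.FreeSubtorusOrbitDimensionBoundStubDiagonalLiftsSchurian

/-!
# `OrbitDimensionBound` (stmt-ValiantsHypothesis-16133), rung line `square_covering` — stub `stub_diagonalLifts`,
# part 2: lifts of diagonal substitutions on a stable pencil are SEMISIMPLE; joint eigenbases

Second helper file for stub 2 `stub_diagonalLifts` of `Cruxes/OrbitDimensionBound/Lines/square_covering.lean` (route
`FreeSubtorus`).  Part 1 (`…StubDiagonalLiftsSchurian`) proved that a stable (block-indecomposable, `det ≠ 0`) affine
pencil `B` is Schurian and that its exact lifts are unique up to scalars.  Here: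

* `exists_jointEigenBasis` — a commuting family of SEMISIMPLE complex matrices (every generalised eigenvector is an
  eigenvector) is simultaneously diagonalised by one base change `P` (Mathlib's
  `iSup_iInf_maxGenEigenspace_eq_top_of_iSup_maxGenEigenspace_eq_top_of_commute`);
* `apply_eq_smul_of_conj_diagonal` — a matrix conjugate to a scalar multiple of a diagonal matrix is semisimple;
* **`lift_semisimple_of_stable`** — for a stable affine pencil `B` and a DIAGONAL substitution `γ = diag(t)` of the
  variables, every exact lift `(G, H)` (`B(γ·x) = G B H⁻¹`) consists of semisimple matrices.  Proof: the
  graded bipartite form `P B Q` of the tree (`FreeSubtorusConfusionCovering.exists_gradedForm`, weights `t`) carries the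
  DIAGONAL lift `(diag β, diag α)` of `γ`; transporting back gives a diagonalisable lift of `γ` on `B`, and by uniqueness
  up to scalars (part 1) every lift is a scalar multiple of it.

NOT here: exact commutation of the lifts over a divisible subgroup and the assembly of `HasDiagonalLifts` (part 3), and
the saturation of `Λ` (open remainder).  Helper mode (`--supports stmt-ValiantsHypothesis-16133 --as helper`).  Honest
framing: [folklore] linear algebra toward ONE registered stub of a dormant rung line whose core `stub_gradedPowerCount` is
OPEN; `OrbitDimensionBound`, `FreeSubtorus` and VP ≠ VNP are OPEN and not moved.

## References
* A. D. King, Quart. J. Math. 45 (1994), Prop. 3.1 — orientation only.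
* [LandsbergRessayre2017] J. M. Landsberg, N. Ressayre, Differential Geom. Appl. 55 (2017), §3.3, §6.
-/

set_option linter.dupNamespace false

namespace Summit.ValiantsHypothesis.ValiantsHypothesis.Theorems.FreeSubtorusOrbitDimensionBound.SquareCovering

open Matrix MvPolynomial Finset Module.End
open Literature.Computability.AlgebraicComplexity LRPencil
open Summit.ValiantsHypothesis.ValiantsHypothesis.Theorems.FreeSubtorusConfusionCovering
open Summit.ValiantsHypothesis.ValiantsHypothesis.Theorems.FreeSubtorusOrbitDimensionBound.SignCovering.PerSummand

/-! ### §1 Joint eigenbasis of a commuting family of semisimple matrices -/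

section Joint

variable {m : ℕ} {ι : Type*}

/-- **Simultaneous diagonalisation.**  A family of pairwise commuting complex matrices `M k`, each of which is
semisimple (generalised eigenvectors are eigenvectors), is conjugated to diagonal matrices by ONE base change:
`M k = P · diag(χ · k) · P'` with `P P' = 1 = P' P`. [folklore] -/
theorem exists_jointEigenBasis (M : ι → Matrix (Fin m) (Fin m) ℂ)
    (hss : ∀ (k : ι) (μ : ℂ) (x : Fin m → ℂ),
      x ∈ Module.End.maxGenEigenspace (Matrix.toLin' (M k)) μ → Matrix.toLin' (M k) x = μ • x)
    (hcomm : ∀ k l, M k * M l = M l * M k) :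
    ∃ (P P' : Matrix (Fin m) (Fin m) ℂ) (χ : Fin m → ι → ℂ),
      P * P' = 1 ∧ P' * P = 1 ∧ ∀ k, M k = P * Matrix.diagonal (fun i => χ i k) * P' := by
  classical
  set f : ι → Module.End ℂ (Fin m → ℂ) := fun k => Matrix.toLin' (M k) with hf
  have hfcomm : Pairwise fun k l => Commute (f k) (f l) := fun k l _ => by
    change f k * f l = f l * f k
    simp only [hf, Module.End.mul_eq_comp, ← Matrix.toLin'_mul, hcomm k l]
  have htop := Module.End.iSup_iInf_maxGenEigenspace_eq_top_of_iSup_maxGenEigenspace_eq_top_of_commute f hfcomm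
    (fun k => Module.End.iSup_maxGenEigenspace_eq_top (f k))
  set T : Set (Fin m → ℂ) := {w | ∃ χ : ι → ℂ, ∀ k, f k w = χ k • w} with hT
  have hspan : Submodule.span ℂ T = ⊤ := by
    rw [eq_top_iff, ← htop]
    refine iSup_le fun χ => ?_
    intro w hw
    refine Submodule.subset_span ⟨χ, fun k => ?_⟩
    exact hss k (χ k) w ((Submodule.mem_iInf _).1 hw k)
  obtain ⟨b, hbT, hbspan, hbli⟩ := exists_linearIndependent ℂ T
  rw [hspan] at hbspan
  have hbfin : b.Finite := LinearIndependent.set_finite_of_isNoetherian hbli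
  letI : Fintype b := hbfin.fintype
  let bas : Module.Basis b ℂ (Fin m → ℂ) :=
    Module.Basis.mk hbli (by rw [Subtype.range_coe_subtype, Set.setOf_mem_eq, hbspan])
  have hcard : Fintype.card b = m := by
    have h1 := Module.finrank_eq_card_basis bas
    rw [Module.finrank_pi, Fintype.card_fin] at h1
    exact h1.symm
  let e : b ≃ Fin m := Fintype.equivFinOfCardEq hcard
  let bas' : Module.Basis (Fin m) ℂ (Fin m → ℂ) := bas.reindex e
  have hbas'T : ∀ i, bas' i ∈ T := fun i => by
    have : bas' i = ((e.symm i : b) : Fin m → ℂ) := by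
      simp [bas', bas, Module.Basis.reindex_apply, Module.Basis.mk_apply]
    rw [this]
    exact hbT (e.symm i).2
  choose χ hχ using hbas'T
  let std := Pi.basisFun ℂ (Fin m)
  refine ⟨std.toMatrix bas', bas'.toMatrix std, χ, std.toMatrix_mul_toMatrix_flip bas',
    bas'.toMatrix_mul_toMatrix_flip std, fun k => ?_⟩
  have key : M k * std.toMatrix bas' = std.toMatrix bas' * Matrix.diagonal (fun i => χ i k) := by
    ext a i
    rw [Matrix.mul_diagonal, Matrix.mul_apply]
    have hcol : ∀ l, std.toMatrix bas' l i = bas' i l := fun l => by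
      simp [std, Module.Basis.toMatrix_apply, Pi.basisFun_repr]
    simp_rw [hcol]
    have := congr_fun (hχ i k) a
    simp only [hf, Matrix.toLin'_apply, Matrix.mulVec, dotProduct, Pi.smul_apply, smul_eq_mul] at this
    rw [this, mul_comm]
  calc M k = M k * (std.toMatrix bas' * bas'.toMatrix std) := by
        rw [std.toMatrix_mul_toMatrix_flip bas', mul_one]
    _ = std.toMatrix bas' * Matrix.diagonal (fun i => χ i k) * bas'.toMatrix std := by
        rw [← Matrix.mul_assoc, key]

end Joint

/-! ### §2 Conjugates of diagonal matrices are semisimple -/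

section Diagonal

variable {m : ℕ}

/-- Powers of a conjugate: `(P' E P)^k = P' E^k P` when `P P' = 1`. [folklore] -/
theorem conj_pow (P P' E : Matrix (Fin m) (Fin m) ℂ) (hPP' : P * P' = 1) (k : ℕ) :
    (P' * E * P) ^ k = P' * E ^ k * P := by
  induction k with
  | zero =>
    rw [pow_zero, pow_zero, Matrix.mul_one]
    exact (mul_eq_one_comm.1 hPP').symm
  | succ k ih =>
    rw [pow_succ, ih, pow_succ]
    simp only [Matrix.mul_assoc]
    rw [← Matrix.mul_assoc P P', hPP', Matrix.one_mul]

/-- A matrix of the form `c · P' diag(δ) P` (`P P' = 1 = P' P`) is semisimple: its generalised eigenvectors are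
eigenvectors. [folklore] -/
theorem apply_eq_smul_of_conj_diagonal (G P P' : Matrix (Fin m) (Fin m) ℂ) (δ : Fin m → ℂ) (c : ℂ)
    (hPP' : P * P' = 1) (hP'P : P' * P = 1) (hG : G = c • (P' * Matrix.diagonal δ * P))
    (μ : ℂ) (x : Fin m → ℂ) (hx : x ∈ Module.End.maxGenEigenspace (Matrix.toLin' G) μ) :
    Matrix.toLin' G x = μ • x := by
  rw [Module.End.mem_maxGenEigenspace] at hx
  obtain ⟨k, hk⟩ := hx
  -- `G - μ = P' diag(c δ - μ) P`
  set E : Matrix (Fin m) (Fin m) ℂ := Matrix.diagonal (fun i => c * δ i - μ) with hE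
  have hGμ : G - μ • (1 : Matrix (Fin m) (Fin m) ℂ) = P' * E * P := by
    rw [hG, hE]
    have h1 : (Matrix.diagonal fun i => c * δ i - μ) = c • Matrix.diagonal δ - μ • (1 : Matrix (Fin m) (Fin m) ℂ) := by
      ext i j
      simp only [Matrix.diagonal_apply, Matrix.sub_apply, Matrix.smul_apply, Matrix.one_apply, smul_eq_mul]
      split_ifs <;> simp
    rw [h1, Matrix.mul_sub, Matrix.sub_mul, Matrix.mul_smul, Matrix.smul_mul, Matrix.mul_smul, Matrix.smul_mul,
      Matrix.mul_one, hP'P]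
  have hlin : (Matrix.toLin' G - μ • 1) ^ k = Matrix.toLin' ((G - μ • (1 : Matrix (Fin m) (Fin m) ℂ)) ^ k) := by
    rw [Matrix.toLin'_pow, map_sub, map_smul, Matrix.toLin'_one]; rfl
  rw [hlin, hGμ, conj_pow P P' E hPP', Matrix.toLin'_apply] at hk
  -- `E^k (P x) = 0` coordinatewise, hence `E (P x) = 0`
  have hEk : E ^ k = Matrix.diagonal (fun i => (c * δ i - μ) ^ k) := by rw [hE, Matrix.diagonal_pow]; rfl
  have h1 : (P' * E ^ k * P).mulVec x = P'.mulVec ((E ^ k).mulVec (P.mulVec x)) := by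
    rw [← Matrix.mulVec_mulVec, ← Matrix.mulVec_mulVec]
  rw [h1] at hk
  have h2 : (E ^ k).mulVec (P.mulVec x) = 0 := by
    have h2' := congrArg (fun y => P.mulVec y) hk
    simp only [Matrix.mulVec_zero] at h2'
    rw [Matrix.mulVec_mulVec, hPP', Matrix.one_mulVec] at h2'
    exact h2'
  have h3 : E.mulVec (P.mulVec x) = 0 := by
    ext i
    have hi := congrFun h2 i
    rw [hEk, Matrix.mulVec_diagonal] at hi
    rw [hE, Matrix.mulVec_diagonal, Pi.zero_apply]
    rw [Pi.zero_apply] at hi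
    rcases mul_eq_zero.1 hi with h | h
    · rw [pow_eq_zero_iff'] at h; rw [h.1, zero_mul]
    · rw [h, mul_zero]
  -- back to `G`
  have h4 : (G - μ • (1 : Matrix (Fin m) (Fin m) ℂ)).mulVec x = 0 := by
    rw [hGμ, ← Matrix.mulVec_mulVec, ← Matrix.mulVec_mulVec, h3, Matrix.mulVec_zero]
  rw [Matrix.sub_mulVec, Matrix.smul_mulVec, Matrix.one_mulVec, sub_eq_zero] at h4
  rw [Matrix.toLin'_apply]
  exact h4

end Diagonal

/-! ### §3 Lifts of diagonal substitutions on a stable pencil are semisimple -/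

section Lifts

variable {n m : ℕ}

/-- `∑_i diag(t) v i • A_i = t v • A_v`. [folklore] -/
theorem sum_diagonal_apply_smul {M : Type*} [AddCommMonoid M] [Module ℂ M] (t : Fin n × Fin n → ℂ)
    (A : Fin n × Fin n → M) (v : Fin n × Fin n) :
    ∑ i, Matrix.diagonal t v i • A i = t v • A v := by
  rw [Finset.sum_eq_single v]
  · rw [Matrix.diagonal_apply_eq]
  · intro i _ hi; rw [Matrix.diagonal_apply_ne _ (Ne.symm hi), zero_smul]
  · intro h; exact absurd (Finset.mem_univ v) h

/-- `∑_j diag(t) j v • A_j = t v • A_v` (transposed indexing). [folklore] -/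
theorem sum_diagonal_apply_smul' {M : Type*} [AddCommMonoid M] [Module ℂ M] (t : Fin n × Fin n → ℂ)
    (A : Fin n × Fin n → M) (v : Fin n × Fin n) :
    ∑ j, Matrix.diagonal t j v • A j = t v • A v := by
  rw [Finset.sum_eq_single v]
  · rw [Matrix.diagonal_apply_eq]
  · intro i _ hi; rw [Matrix.diagonal_apply_ne _ hi, zero_smul]
  · intro h; exact absurd (Finset.mem_univ v) h

/-- **Affine entries under a diagonal substitution.**  If an affine polynomial `C c₀ + Σ_p C c_p X_p` has its constant
supported on `b = a` and its `X_p`-coefficient supported on `b = t_p a` (`a ≠ 0`), then the diagonal substitution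
`X_p ↦ t_p X_p` multiplies it by `b / a`. [folklore] -/
theorem linSubst_diagonal_affine (t : Fin n × Fin n → ℂ) (c₀ : ℂ) (c : Fin n × Fin n → ℂ) (a b : ℂ) (ha : a ≠ 0)
    (h₀ : c₀ ≠ 0 → b = a) (h₁ : ∀ p, c p ≠ 0 → b = t p * a) :
    linSubst (Fin n × Fin n) ℂ (Matrix.diagonal t) (C c₀ + ∑ p, C (c p) * X p) =
      C b * (C c₀ + ∑ p, C (c p) * X p) * C a⁻¹ := by
  have hainv : (C a : MvPolynomial (Fin n × Fin n) ℂ) * C a⁻¹ = 1 := by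
    rw [← map_mul, mul_inv_cancel₀ ha, C_1]
  have hconst : (C c₀ : MvPolynomial (Fin n × Fin n) ℂ) = C b * C c₀ * C a⁻¹ := by
    by_cases hc : c₀ = 0
    · rw [hc, C_0, mul_zero, zero_mul]
    · rw [h₀ hc]
      linear_combination (-(C c₀ : MvPolynomial (Fin n × Fin n) ℂ)) * hainv
  have hterm : ∀ p, (C (c p) * (t p • X p) : MvPolynomial (Fin n × Fin n) ℂ) = C b * (C (c p) * X p) * C a⁻¹ := by
    intro p
    rw [smul_eq_C_mul]
    by_cases hc : c p = 0
    · rw [hc, C_0, zero_mul, zero_mul, mul_zero, zero_mul]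
    · rw [h₁ p hc, map_mul]
      linear_combination (-(C (c p) * C (t p) * X p : MvPolynomial (Fin n × Fin n) ℂ)) * hainv
  have hL : linSubst (Fin n × Fin n) ℂ (Matrix.diagonal t) (C c₀ + ∑ p, C (c p) * X p) =
      C c₀ + ∑ p, C (c p) * (t p • X p) := by
    simp only [map_add, map_sum, map_mul, linSubst_C, linSubst_X, sum_diagonal_apply_smul']
  have hR : C b * (C c₀ + ∑ p, C (c p) * X p) * C a⁻¹ =
      C b * C c₀ * C a⁻¹ + ∑ p, C b * (C (c p) * X p) * C a⁻¹ := by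
    rw [mul_add, add_mul, Finset.mul_sum Finset.univ (fun p => C (c p) * X p) (C b),
      Finset.sum_mul Finset.univ (fun p => C b * (C (c p) * X p)) (C a⁻¹)]
  rw [hL, hR, ← hconst]
  exact congrArg _ (Finset.sum_congr rfl fun p _ => hterm p)

/-- A generalised eigenvalue of positive multiplicity of an invertible matrix is non-zero. [folklore] -/
theorem ne_zero_of_finrank_maxGen_ne_zero (G : GL (Fin m) ℂ) (μ : ℂ)
    (h : Module.finrank ℂ (Module.End.maxGenEigenspace (Matrix.toLin' (G : Matrix (Fin m) (Fin m) ℂ)) μ) ≠ 0) :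
    μ ≠ 0 := by
  intro hμ
  subst hμ
  apply h
  rw [Submodule.finrank_eq_zero]
  rw [eq_bot_iff]
  intro x hx
  rw [Module.End.mem_maxGenEigenspace] at hx
  obtain ⟨k, hk⟩ := hx
  rw [zero_smul, sub_zero, ← Matrix.toLin'_pow, Matrix.toLin'_apply] at hk
  rw [Submodule.mem_bot]
  have hdet : ((G : Matrix (Fin m) (Fin m) ℂ) ^ k).det ≠ 0 := by
    rw [Matrix.det_pow]
    exact pow_ne_zero _ (by
      simpa [Matrix.GeneralLinearGroup.val_det_apply] using (Matrix.GeneralLinearGroup.det G).ne_zero)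
  exact Matrix.eq_zero_of_mulVec_eq_zero hdet hk

/-- **Lifts of diagonal substitutions on stable pencils are semisimple.**  Let `B` be an affine square matrix with
`det B ≠ 0` which is not block-decomposable, `γ = diag(t)` an invertible diagonal substitution of the variables, and
`(G, H)` an exact lift: `B(γ·x) = G B H⁻¹`.  Then `G` and `H` are semisimple (their generalised eigenvectors are
eigenvectors).  [folklore] -/
theorem lift_semisimple_of_stable (B : Matrix (Fin m) (Fin m) (MvPolynomial (Fin n × Fin n) ℂ))
    (haff : ∀ i j, (B i j).totalDegree ≤ 1) (hM : B.det ≠ 0) (hnb : ¬ IsBlockDecomposable B)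
    (t : Fin n × Fin n → ℂ) (γ : GL (Fin n × Fin n) ℂ)
    (hγ : (γ : Matrix (Fin n × Fin n) (Fin n × Fin n) ℂ) = Matrix.diagonal t) (G H : GL (Fin m) ℂ)
    (hlift : Matrix.linSubstEntries γ B =
      (G : Matrix (Fin m) (Fin m) ℂ).map C * B * ((H⁻¹ : GL (Fin m) ℂ) : Matrix (Fin m) (Fin m) ℂ).map C) :
    (∀ (μ : ℂ) (x : Fin m → ℂ), x ∈ Module.End.maxGenEigenspace (Matrix.toLin' (G : Matrix (Fin m) (Fin m) ℂ)) μ →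
        Matrix.toLin' (G : Matrix (Fin m) (Fin m) ℂ) x = μ • x) ∧
      (∀ (μ : ℂ) (x : Fin m → ℂ), x ∈ Module.End.maxGenEigenspace (Matrix.toLin' (H : Matrix (Fin m) (Fin m) ℂ)) μ →
        Matrix.toLin' (H : Matrix (Fin m) (Fin m) ℂ) x = μ • x) := by
  classical
  set Gm : Matrix (Fin m) (Fin m) ℂ := (G : Matrix (Fin m) (Fin m) ℂ) with hGm
  set Hm : Matrix (Fin m) (Fin m) ℂ := (H : Matrix (Fin m) (Fin m) ℂ) with hHm
  set Hi : Matrix (Fin m) (Fin m) ℂ := ((H⁻¹ : GL (Fin m) ℂ) : Matrix (Fin m) (Fin m) ℂ) with hHi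
  have hHiH : Hi * Hm = 1 := by rw [hHi, hHm, ← Units.val_mul, inv_mul_cancel, Units.val_one]
  -- the intertwining relations of the lift
  have h0 : Gm * constPart B = constPart B * Hm := mul_constPart_eq_of_linSubstEntries_eq hlift
  have hv : ∀ p, Gm * coeffMat B p = t p • (coeffMat B p * Hm) := by
    intro p
    have e1 := congrArg (fun A => coeffMat A p) hlift
    rw [coeffMat_linSubstEntries _ _ haff, hγ, sum_diagonal_apply_smul, coeffMat_C_mul_mul_C] at e1
    -- `t p • B_p = G B_p H⁻¹`
    calc Gm * coeffMat B p = Gm * coeffMat B p * (Hi * Hm) := by rw [hHiH, Matrix.mul_one]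
      _ = (t p • coeffMat B p) * Hm := by rw [← Matrix.mul_assoc, ← e1]
      _ = t p • (coeffMat B p * Hm) := by rw [Matrix.smul_mul]
  -- graded bipartite form
  obtain ⟨P, Q, α, β, hc, hx, hβ, hα⟩ := exists_gradedForm B t Gm Hm h0 hv
  set Pm : Matrix (Fin m) (Fin m) ℂ := (P : Matrix (Fin m) (Fin m) ℂ) with hPm
  set Pi : Matrix (Fin m) (Fin m) ℂ := ((P⁻¹ : GL (Fin m) ℂ) : Matrix (Fin m) (Fin m) ℂ) with hPi
  set Qm : Matrix (Fin m) (Fin m) ℂ := (Q : Matrix (Fin m) (Fin m) ℂ) with hQm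
  set Qi : Matrix (Fin m) (Fin m) ℂ := ((Q⁻¹ : GL (Fin m) ℂ) : Matrix (Fin m) (Fin m) ℂ) with hQi
  have hPPi : Pm * Pi = 1 := by rw [hPi, hPm, ← Units.val_mul, mul_inv_cancel, Units.val_one]
  have hPiP : Pi * Pm = 1 := by rw [hPi, hPm, ← Units.val_mul, inv_mul_cancel, Units.val_one]
  have hQQi : Qm * Qi = 1 := by rw [hQi, hQm, ← Units.val_mul, mul_inv_cancel, Units.val_one]
  have hQiQ : Qi * Qm = 1 := by rw [hQi, hQm, ← Units.val_mul, inv_mul_cancel, Units.val_one]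
  set B' : Matrix (Fin m) (Fin m) (MvPolynomial (Fin n × Fin n) ℂ) := Pm.map C * B * Qm.map C with hB'
  -- the grades are non-zero
  have hβ0 : ∀ i, β i ≠ 0 := by
    intro i
    refine ne_zero_of_finrank_maxGen_ne_zero G (β i) ?_
    rw [← hGm, ← hβ (β i)]
    exact Finset.card_ne_zero.2 ⟨i, by simp⟩
  have hα0 : ∀ j, α j ≠ 0 := by
    intro j
    refine ne_zero_of_finrank_maxGen_ne_zero H (α j) ?_
    rw [← hHm, ← hα (α j)]
    exact Finset.card_ne_zero.2 ⟨j, by simp⟩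
  -- the diagonal lift of `γ` on `B'`
  set Dβ : Matrix (Fin m) (Fin m) ℂ := Matrix.diagonal β with hDβ
  set Dα : Matrix (Fin m) (Fin m) ℂ := Matrix.diagonal α with hDα
  set Dαi : Matrix (Fin m) (Fin m) ℂ := Matrix.diagonal (fun j => (α j)⁻¹) with hDαi
  have hDαDαi : Dα * Dαi = 1 := by
    rw [hDα, hDαi, Matrix.diagonal_mul_diagonal, ← Matrix.diagonal_one]
    congr 1; ext j; exact mul_inv_cancel₀ (hα0 j)
  have hDαiDα : Dαi * Dα = 1 := mul_eq_one_comm.1 hDαDαi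
  have haff' : ∀ i j, (B' i j).totalDegree ≤ 1 := totalDegree_map_C_mul_mul_map_C_le Pm Qm haff
  have hE : Matrix.linSubstEntries γ B' = Dβ.map C * B' * Dαi.map C := by
    apply Matrix.ext
    intro i j
    have hL : Matrix.linSubstEntries γ B' i j = linSubst (Fin n × Fin n) ℂ (γ : Matrix _ _ ℂ) (B' i j) := rfl
    have hR : (Dβ.map C * B' * Dαi.map C : Matrix (Fin m) (Fin m) (MvPolynomial (Fin n × Fin n) ℂ)) i j =
        C (β i) * B' i j * C (α j)⁻¹ := by
      rw [hDβ, hDαi, Matrix.diagonal_map (C_0), Matrix.diagonal_map (C_0), Matrix.mul_diagonal,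
        Matrix.diagonal_mul]
    rw [hL, hR, hγ]
    have haffij := eq_affine_of_totalDegree_le_one (B' i j) (haff' i j)
    conv_lhs => rw [haffij]
    conv_rhs => rw [haffij]
    refine linSubst_diagonal_affine t _ _ (α j) (β i) (hα0 j) (fun h => hc i j ?_) (fun p h => hx p i j ?_)
    · simpa [constPart_apply, constantCoeff_eq] using h
    · simpa [coeffMat_apply] using h
  -- transport the diagonal lift back to `B`: `γB = (Pi Dβ Pm) B (Qm Dα Qi)⁻¹`
  have hdetDβ : Dβ.det ≠ 0 := by
    rw [hDβ, Matrix.det_diagonal]; exact Finset.prod_ne_zero_iff.2 fun i _ => hβ0 i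
  have hdetDα : Dα.det ≠ 0 := by
    rw [hDα, Matrix.det_diagonal]; exact Finset.prod_ne_zero_iff.2 fun j _ => hα0 j
  set Dβu : GL (Fin m) ℂ := Matrix.GeneralLinearGroup.mkOfDetNeZero Dβ hdetDβ with hDβu
  set Dαu : GL (Fin m) ℂ := Matrix.GeneralLinearGroup.mkOfDetNeZero Dα hdetDα with hDαu
  have hDαu_inv : ((Dαu⁻¹ : GL (Fin m) ℂ) : Matrix (Fin m) (Fin m) ℂ) = Dαi := by
    rw [Matrix.coe_units_inv, hDαu, Matrix.GeneralLinearGroup.val_mkOfDetNeZero]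
    exact Matrix.inv_eq_right_inv hDαDαi
  set G₀ : GL (Fin m) ℂ := P⁻¹ * Dβu * P with hG₀
  set H₀ : GL (Fin m) ℂ := Q * Dαu * Q⁻¹ with hH₀
  have hG₀coe : (G₀ : Matrix (Fin m) (Fin m) ℂ) = Pi * Dβ * Pm := by
    rw [hG₀, Units.val_mul, Units.val_mul, hDβu, Matrix.GeneralLinearGroup.val_mkOfDetNeZero]
  have hH₀coe : (H₀ : Matrix (Fin m) (Fin m) ℂ) = Qm * Dα * Qi := by
    rw [hH₀, Units.val_mul, Units.val_mul, hDαu, Matrix.GeneralLinearGroup.val_mkOfDetNeZero]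
  have hH₀inv : ((H₀⁻¹ : GL (Fin m) ℂ) : Matrix (Fin m) (Fin m) ℂ) = Qm * Dαi * Qi := by
    rw [hH₀, _root_.mul_inv_rev, _root_.mul_inv_rev, inv_inv, Units.val_mul, Units.val_mul, hDαu_inv, Matrix.mul_assoc]
  have hlift₀ : Matrix.linSubstEntries γ B =
      (G₀ : Matrix (Fin m) (Fin m) ℂ).map C * B * ((H₀⁻¹ : GL (Fin m) ℂ) : Matrix (Fin m) (Fin m) ℂ).map C := by
    -- `B = Pi B' Qi`
    have hBB' : B = Pi.map C * B' * Qi.map C := by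
      rw [hB', ← Matrix.mul_assoc, ← Matrix.mul_assoc, ← Matrix.map_mul, hPiP, Matrix.map_one C C_0 C_1,
        Matrix.one_mul, Matrix.mul_assoc, ← Matrix.map_mul, hQQi, Matrix.map_one C C_0 C_1, Matrix.mul_one]
    rw [hG₀coe, hH₀inv]
    conv_lhs => rw [hBB']
    rw [Matrix.linSubstEntries_mul, Matrix.linSubstEntries_mul, Matrix.linSubstEntries_map_C,
      Matrix.linSubstEntries_map_C, hE, hB']
    simp only [Matrix.map_mul, Matrix.mul_assoc]
  -- uniqueness up to a scalar
  obtain ⟨c, hGc, hHc⟩ := lift_eq_smul_of_not_isBlockDecomposable B hM hnb G H G₀ H₀ (hlift.symm.trans hlift₀)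
  rw [hG₀coe] at hGc
  rw [hH₀coe] at hHc
  refine ⟨fun μ x hx' => ?_, fun μ x hx' => ?_⟩
  · exact apply_eq_smul_of_conj_diagonal Gm Pm Pi β c hPPi hPiP (by rw [hGm, hGc]) μ x (by rwa [hGm] at hx')
  · exact apply_eq_smul_of_conj_diagonal Hm Qi Qm α c hQiQ hQQi (by rw [hHm, hHc]) μ x (by rwa [hHm] at hx')

end Lifts

end Summit.ValiantsHypothesis.ValiantsHypothesis.Theorems.FreeSubtorusOrbitDimensionBound.SquareCovering
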